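import Summits.ResolutionOfSingularities.ResolutionOfSingularities.Theorems.FrobeniusClosingSteerHatConeStages
import HarnessLib

/-!
# Crux `Steer` (stmt-ResolutionOfSingularities-16345), chain W4.1 — CONE PERSISTENCE along an x-chart letter, part 3/3:
# `Ψ̄₁ = λ·(Ψ̄ ⊗_ī κ₁)` and the anisotropy of `Ψ̄ ⊗_ī κ₁`

OURS (campaign `res-hironaka`, rung L ★L-G4, slot W4.1; seat res-L0-w41-stub-4 g7 on res-L0-w41-plan-1 RULINGS 196d/207(a) — «CONTINUE the cone
lemmas … `conePersistenceX_holds` is YOURS»). Replaces the role of no printed item; NOT a statement of the manuscript under review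
[claim: Hironaka2017, status: under-review]; AI-produced, weaker than expert review. Theses-free, definition-free, WORDS-FREE.

* §7 `cone_coeff` — the exponent comparison `2k + a₁ = a + b + d` and the scalar, by coefficient extraction on
  `X₀^(a+b)·(C c + X₁)^b·F = X₀^(2k+a₁)·X₁^(b₁)·F₁` at `(a+b+d, b, i₀, j₀)`, `(2k+a₁, b₁, i₁, j₁)`, `(a+b+d, b₁, i, j)`; cases `(b, b₁)`:
  `(0,0), (1,1)`: `λ = 1`; `(1,0)`: `λ = c` (`≠ 0` since `Ψ̄₁ ≠ 0`); `(0,1)`: impossible (`Ψ̄₁ = 0`). No valuation or primality argument is needed.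
* §8 **`conePersistence_core`** — along an x-chart letter `φ : S → S₁` in section form between stage data with square-free twists
  `u = x^a y^b`, `u₁ = x₁^(a₁) v₁^(b₁)` and the radicand relation `φ(u f) = x₁^(2k)·u₁ f₁`: `Ψ̄₁ = λ·(Ψ̄ ⊗_ī κ₁)` for a NONZERO `λ ∈ κ₁`
  (`ī = residue₁ ∘ φ ∘ σ`; `S₁` complete regular local of dimension four, perfect residue field of characteristic `p`; `S` any local ring with
  a section). Helper `exists_coeff_ne_zero_of_map_ne_zero`.
* §9 **`coneAnisotropy_core`** — consumer form: `Ψ̄` and `Ψ̄₁` anisotropic ⇒ `Ψ̄ ⊗_ī κ₁` anisotropic over `κ₁` = the input of the last clause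
  of the re-cut β-slot `HatBaseChangeX` (res-L0-w41-plan-1 RULING 207(a)); `map_ne_zero_of_anisotropic`.
The word-level `conePersistenceX_holds` (idea-1's `ConePersistenceX` in this currency, `L/res-L0-w41-stub-4/CONE-SHAPE.md`) is a short
wrapper over `conePersistence_core` once the words file `…BetaHatStageWords` (p552756) has an olean.

[cite: CossartJannsenSaito2020, Lemma 12.1 (2)] [cite: Matsumura1987, Thm. 28.3] [folklore]
bears_on: LADDER-RESOLUTION L ★L-G4 W4.1 (crux `Steer`, binder hK4ⁿᶜ, β-slots `HatBaseChangeX` / `ConePersistenceX`).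
-/

noncomputable section

-- `Summit.<S>.<S>.…` duplicates the summit name by design (single-problem summit).
set_option linter.dupNamespace false

open MvPowerSeries IsLocalRing
open Literature.RingTheory.CompleteLocalRings

namespace Summit.ResolutionOfSingularities.ResolutionOfSingularities.Theorems.SwitchingDichotomy.HatBaseChange

/-! ## §7 Cone persistence in Cohen coordinates: exponent comparison and the scalar `λ` -/

section ConeCohen
variable {k : Type} [Field k]

/-- Shifted coefficient, in range. -/
theorem coeff_X_pow_mul_of_le (s : Fin 4) {n : ℕ} {m : Fin 4 →₀ ℕ} (h : n ≤ m s) (G : MvPowerSeries (Fin 4) k) :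
    coeff m (X s ^ n * G) = coeff (m - Finsupp.single s n) G := by
  rw [coeff_X_pow_mul_eq, if_pos h]

/-- Shifted coefficient, out of range. -/
theorem coeff_X_pow_mul_of_lt (s : Fin 4) {n : ℕ} {m : Fin 4 →₀ ℕ} (h : m s < n) (G : MvPowerSeries (Fin 4) k) :
    coeff m (X s ^ n * G) = 0 := by
  rw [coeff_X_pow_mul_eq, if_neg (by omega)]

/-- The exponent `(n, β, i, j)`. -/
theorem quad_apply (n β i j : ℕ) :
    (Finsupp.single (0 : Fin 4) n + Finsupp.single 1 β + Finsupp.single 2 i + Finsupp.single 3 j : Fin 4 →₀ ℕ) 0 = n ∧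
    (Finsupp.single (0 : Fin 4) n + Finsupp.single 1 β + Finsupp.single 2 i + Finsupp.single 3 j : Fin 4 →₀ ℕ) 1 = β ∧
    (Finsupp.single (0 : Fin 4) n + Finsupp.single 1 β + Finsupp.single 2 i + Finsupp.single 3 j : Fin 4 →₀ ℕ) 2 = i ∧
    (Finsupp.single (0 : Fin 4) n + Finsupp.single 1 β + Finsupp.single 2 i + Finsupp.single 3 j : Fin 4 →₀ ℕ) 3 = j := by
  simp

/-- Subtracting along one coordinate. -/
theorem quad_sub_single_zero (n n' β i j : ℕ) :
    (Finsupp.single (0 : Fin 4) n + Finsupp.single 1 β + Finsupp.single 2 i + Finsupp.single 3 j) - Finsupp.single 0 n' =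
      Finsupp.single (0 : Fin 4) (n - n') + Finsupp.single 1 β + Finsupp.single 2 i + Finsupp.single 3 j := by
  ext t; fin_cases t <;> simp

/-- Subtracting along the second coordinate. -/
theorem quad_sub_single_one (n β β' i j : ℕ) :
    (Finsupp.single (0 : Fin 4) n + Finsupp.single 1 β + Finsupp.single 2 i + Finsupp.single 3 j) - Finsupp.single 1 β' =
      Finsupp.single (0 : Fin 4) n + Finsupp.single 1 (β - β') + Finsupp.single 2 i + Finsupp.single 3 j := by
  ext t; fin_cases t <;> simp

/-- Coefficients of `(C c + X₁)^b · F` for `b ≤ 1`. -/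
theorem coeff_C_add_X_pow_mul (b : ℕ) (hb : b ≤ 1) (c : k) (m : Fin 4 →₀ ℕ) (F : MvPowerSeries (Fin 4) k) :
    coeff m ((C c + X 1) ^ b * F) =
      if b = 0 then coeff m F else c * coeff m F + if 1 ≤ m 1 then coeff (m - Finsupp.single 1 1) F else 0 := by
  rcases Nat.le_one_iff_eq_zero_or_eq_one.mp hb with rfl | rfl
  · rw [pow_zero, one_mul, if_pos rfl]
  · rw [pow_one, if_neg one_ne_zero, coeff_C_add_X_mul_eq]

/-- **CONE PERSISTENCE, coefficient form.** In `κ₁⟦X₀..X₃⟧` let `F, F₁` satisfy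
`X₀^(a+b)·(C c + X₁)^b·F = X₀^M·X₁^(b₁)·F₁` (`b, b₁ ≤ 1`), where `F` has no coefficients in `X₀`-degree `< d` and its coefficients at
`X₀^d X₁^β X₂^i X₃^j` (`i + j = d`) are `[β = 0]·g(i,j)`, and `F₁`'s coefficients at `X₂^i X₃^j` (`i + j = d`) are `g₁(i,j)`; if `g ≢ 0` and
`g₁ ≢ 0` on `i + j = d` then `g₁ = λ·g` there for one `λ ≠ 0` (and `M = a + b + d`). -/
theorem cone_coeff (a b b₁ d M : ℕ) (hb : b ≤ 1) (c : k) (F F₁ : MvPowerSeries (Fin 4) k)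
    (g g₁ : ℕ → ℕ → k)
    (hrel : X 0 ^ (a + b) * (C c + X 1) ^ b * F = X 0 ^ M * X 1 ^ b₁ * F₁)
    (hFlt : ∀ m : Fin 4 →₀ ℕ, m 2 + m 3 = d → m 0 < d → coeff m F = 0)
    (hFeq : ∀ m : Fin 4 →₀ ℕ, m 2 + m 3 = d → m 0 = d → coeff m F = if m 1 = 0 then g (m 2) (m 3) else 0)
    (hF₁ : ∀ m : Fin 4 →₀ ℕ, m 0 = 0 → m 1 = 0 → m 2 + m 3 = d → coeff m F₁ = g₁ (m 2) (m 3))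
    (hg : ∃ i j, i + j = d ∧ g i j ≠ 0) (hg₁ : ∃ i j, i + j = d ∧ g₁ i j ≠ 0) :
    ∃ l : k, l ≠ 0 ∧ ∀ i j, i + j = d → g₁ i j = l * g i j := by
  -- RHS at `(M, b₁, i, j)` and at `X₀`-degree `< M`
  have hReq : ∀ i j, i + j = d →
      coeff (Finsupp.single (0 : Fin 4) M + Finsupp.single 1 b₁ + Finsupp.single 2 i + Finsupp.single 3 j)
        (X 0 ^ M * X 1 ^ b₁ * F₁) = g₁ i j := by
    intro i j hij
    obtain ⟨q0, q1, q2, q3⟩ := quad_apply M b₁ i j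
    rw [mul_assoc, coeff_X_pow_mul_of_le 0 (by rw [q0]) _, quad_sub_single_zero, Nat.sub_self]
    obtain ⟨r0, r1, r2, r3⟩ := quad_apply 0 b₁ i j
    rw [coeff_X_pow_mul_of_le 1 (by rw [r1]) _, quad_sub_single_one, Nat.sub_self]
    obtain ⟨t0, t1, t2, t3⟩ := quad_apply 0 0 i j
    rw [hF₁ _ t0 t1 (by rw [t2, t3]; exact hij), t2, t3]
  have hRlt : ∀ n β i j, n < M →
      coeff (Finsupp.single (0 : Fin 4) n + Finsupp.single 1 β + Finsupp.single 2 i + Finsupp.single 3 j)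
        (X 0 ^ M * X 1 ^ b₁ * F₁) = 0 := by
    intro n β i j hn
    obtain ⟨q0, -, -, -⟩ := quad_apply n β i j
    rw [mul_assoc, coeff_X_pow_mul_of_lt 0 (by rw [q0]; exact hn)]
  -- LHS at `(a+b+d, β, i, j)` and at `X₀`-degree `< a+b+d`
  have hLeq : ∀ β i j, i + j = d →
      coeff (Finsupp.single (0 : Fin 4) (a + b + d) + Finsupp.single 1 β + Finsupp.single 2 i + Finsupp.single 3 j)
        (X 0 ^ (a + b) * (C c + X 1) ^ b * F) =
        if β = b then g i j else if b = 1 ∧ β = 0 then c * g i j else 0 := by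
    intro β i j hij
    obtain ⟨q0, q1, q2, q3⟩ := quad_apply (a + b + d) β i j
    rw [mul_assoc, coeff_X_pow_mul_of_le 0 (by rw [q0]; omega) _, quad_sub_single_zero, Nat.add_sub_cancel_left,
      coeff_C_add_X_pow_mul b hb]
    obtain ⟨r0, r1, r2, r3⟩ := quad_apply d β i j
    rw [hFeq _ (by rw [r2, r3]; exact hij) r0, r1, r2, r3, quad_sub_single_one]
    obtain ⟨t0, t1, t2, t3⟩ := quad_apply d (β - 1) i j
    rw [hFeq _ (by rw [t2, t3]; exact hij) t0, t1, t2, t3]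
    rcases Nat.le_one_iff_eq_zero_or_eq_one.mp hb with hb0 | hb1
    · rw [if_pos hb0, hb0]
      by_cases hβ : β = 0
      · rw [if_pos hβ, if_pos hβ]
      · rw [if_neg hβ, if_neg hβ, if_neg (by omega)]
    · rw [if_neg (by omega), hb1]
      by_cases hβ0 : β = 0
      · rw [hβ0]; simp
      by_cases hβ1 : β = 1
      · rw [hβ1]; simp
      · rw [if_neg hβ0, if_pos (by omega), if_neg (by omega), if_neg hβ1, if_neg (by omega), mul_zero, zero_add]
  have hLlt : ∀ n β i j, i + j = d → n < a + b + d →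
      coeff (Finsupp.single (0 : Fin 4) n + Finsupp.single 1 β + Finsupp.single 2 i + Finsupp.single 3 j)
        (X 0 ^ (a + b) * (C c + X 1) ^ b * F) = 0 := by
    intro n β i j hij hn
    obtain ⟨q0, q1, q2, q3⟩ := quad_apply n β i j
    rw [mul_assoc]
    by_cases hab : a + b ≤ n
    · rw [coeff_X_pow_mul_of_le 0 (by rw [q0]; exact hab) _, quad_sub_single_zero, coeff_C_add_X_pow_mul b hb]
      obtain ⟨r0, r1, r2, r3⟩ := quad_apply (n - (a + b)) β i j
      rw [hFlt _ (by rw [r2, r3]; exact hij) (by rw [r0]; omega), r1, quad_sub_single_one]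
      obtain ⟨t0, -, t2, t3⟩ := quad_apply (n - (a + b)) (β - 1) i j
      rw [hFlt _ (by rw [t2, t3]; exact hij) (by rw [t0]; omega)]
      simp
    · rw [coeff_X_pow_mul_of_lt 0 (by rw [q0]; omega)]
  obtain ⟨i₀, j₀, hij₀, hg₀⟩ := hg
  obtain ⟨i₁, j₁, hij₁, hg₁'⟩ := hg₁
  -- `M ≤ a + b + d`: evaluate at `(a+b+d, b, i₀, j₀)`
  have hM1 : M ≤ a + b + d := by
    by_contra hlt
    have h := hLeq b i₀ j₀ hij₀
    rw [hrel, hRlt _ _ _ _ (by omega), if_pos rfl] at h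
    exact hg₀ h.symm
  -- `a + b + d ≤ M`: evaluate at `(M, b₁, i₁, j₁)`
  have hM2 : a + b + d ≤ M := by
    by_contra hlt
    have h := hReq i₁ j₁ hij₁
    rw [← hrel, hLlt _ _ _ _ hij₁ (by omega)] at h
    exact hg₁' h.symm
  have hM : M = a + b + d := le_antisymm hM1 hM2
  -- the values at `(M, b₁, i, j)`
  have hval : ∀ i j, i + j = d → g₁ i j = (if b₁ = b then g i j else if b = 1 ∧ b₁ = 0 then c * g i j else 0) := by
    intro i j hij
    rw [← hReq i j hij, ← hrel, hM, hLeq b₁ i j hij]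
  by_cases hbb : b₁ = b
  · refine ⟨1, one_ne_zero, fun i j hij => ?_⟩
    rw [hval i j hij, if_pos hbb, one_mul]
  by_cases hb10 : b = 1 ∧ b₁ = 0
  · refine ⟨c, ?_, fun i j hij => ?_⟩
    · intro hc
      apply hg₁'
      rw [hval i₁ j₁ hij₁, if_neg hbb, if_pos hb10, hc, zero_mul]
    · rw [hval i j hij, if_neg hbb, if_pos hb10]
  · exfalso
    apply hg₁'
    rw [hval i₁ j₁ hij₁, if_neg hbb, if_neg hb10]

end ConeCohen


/-! ## §8 CONE PERSISTENCE along an x-chart letter between arithmetic stages (words-free core) -/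

section Core
variable {S S₁ : Type} [CommRing S] [IsLocalRing S] [CommRing S₁] [IsLocalRing S₁]

/-- A nonzero homogeneous form of degree `d` has a nonzero coefficient in degree `d`, read through an injective map. -/
theorem exists_coeff_ne_zero_of_map_ne_zero {A B : Type} [CommRing A] [CommRing B] (g : A →+* B) (d : ℕ) (Ψ : MvPolynomial (Fin 2) A)
    (hΨ : Ψ.IsHomogeneous d) (h0 : MvPolynomial.map g Ψ ≠ 0) :
    ∃ i j, i + j = d ∧ g (MvPolynomial.coeff (Finsupp.single 0 i + Finsupp.single 1 j) Ψ) ≠ 0 := by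
  obtain ⟨e, he⟩ := MvPolynomial.ne_zero_iff.mp h0
  rw [MvPolynomial.coeff_map] at he
  have hpair : e = Finsupp.single 0 (e 0) + Finsupp.single 1 (e 1) := by ext t; fin_cases t <;> simp
  refine ⟨e 0, e 1, ?_, by rwa [← hpair]⟩
  by_contra hne
  apply he
  rw [hΨ.coeff_eq_zero (by rw [Finsupp.degree_eq_sum, Fin.sum_univ_two]; exact hne), map_zero]

/-- **CONE PERSISTENCE (words-free core).** Along an x-chart letter `φ : S → S₁` in section form (coefficient fields `σ, σ₁`,
compatibility, r.s.o.p. `(x,y,z,w)` of `S` sent to `(x₁, x₁(σ₁ c + v₁), x₁ z₁, x₁ w₁)` with `(x₁, v₁, z₁, w₁)` an r.s.o.p. of the complete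
regular local ring `S₁` of dimension four with perfect residue field of characteristic `p`), with square-free twists `u = x^a y^b`,
`u₁ = x₁^(a₁) v₁^(b₁)` and the radicand relation `φ (u f) = x₁^(2k) · u₁ f₁`: if `f ≡ Ψ(z,w)` and `f₁ ≡ Ψ₁(z₁,w₁)` modulo the stage ideals
`(x,y)·𝔪^(d−1) + 𝔪^(d+1)` resp. `(x₁,v₁)·𝔪₁^(d−1) + 𝔪₁^(d+1)` for degree-`d` forms with NONZERO residue forms, then
`Ψ̄₁ = λ · (Ψ̄ ⊗_ī κ₁)` for a nonzero scalar `λ ∈ κ₁` (`ī = residue₁ ∘ φ ∘ σ`). In particular `Ψ̄ ⊗_ī κ₁` is anisotropic iff `Ψ̄₁` is.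
[cite: CossartJannsenSaito2020, Lemma 12.1 (2)] [folklore: the tangent cone of the strict transform at a near point] -/
theorem conePersistence_core (p : ℕ) (hp : p.Prime) [CharP S₁ p] (hreg₁ : IsRegularLocalRing S₁) [IsAdicComplete (maximalIdeal S₁) S₁]
    [PerfectField (ResidueField S₁)] (hdim₁ : ringKrullDim S₁ = 4)
    (φ : S →+* S₁) (σ : ResidueField S →+* S) (σ₁ : ResidueField S₁ →+* S₁)
    (hσ : ∀ a, residue S (σ a) = a) (hσ₁ : ∀ b, residue S₁ (σ₁ b) = b)
    (hcompat : ∀ a, φ (σ a) = σ₁ (residue S₁ (φ (σ a))))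
    (x y z w u f : S) (c : ResidueField S₁) (v₁ z₁ w₁ u₁ f₁ : S₁)
    (hspan : Ideal.span {x, y, z, w} = maximalIdeal S) (hspan₁ : Ideal.span {φ x, v₁, z₁, w₁} = maximalIdeal S₁)
    (hy : φ y = φ x * (σ₁ c + v₁)) (hz : φ z = φ x * z₁) (hw : φ w = φ x * w₁)
    (a b a₁ b₁ k d : ℕ) (hb : b ≤ 1) (hd : 1 ≤ d) (hu : u = x ^ a * y ^ b) (hu₁ : u₁ = φ x ^ a₁ * v₁ ^ b₁)
    (hrel : φ (u * f) = φ x ^ (2 * k) * (u₁ * f₁))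
    (Ψ : MvPolynomial (Fin 2) S) (hΨ : Ψ.IsHomogeneous d)
    (hcong : f - MvPolynomial.eval ![z, w] Ψ ∈ Ideal.span {x, y} * maximalIdeal S ^ (d - 1) ⊔ maximalIdeal S ^ (d + 1))
    (hΨ0 : MvPolynomial.map (residue S) Ψ ≠ 0)
    (Ψ₁ : MvPolynomial (Fin 2) S₁) (hΨ₁ : Ψ₁.IsHomogeneous d)
    (hcong₁ : f₁ - MvPolynomial.eval ![z₁, w₁] Ψ₁ ∈ Ideal.span {φ x, v₁} * maximalIdeal S₁ ^ (d - 1) ⊔ maximalIdeal S₁ ^ (d + 1))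
    (hΨ₁0 : MvPolynomial.map (residue S₁) Ψ₁ ≠ 0) :
    ∃ l : ResidueField S₁, l ≠ 0 ∧ MvPolynomial.map (residue S₁) Ψ₁ =
      MvPolynomial.C l * MvPolynomial.map (((residue S₁).comp (φ.comp σ)).comp (residue S)) Ψ := by
  classical
  haveI := hreg₁
  haveI : Fact p.Prime := ⟨hp⟩
  -- Cohen coordinates of `S₁` adapted to `(x₁, v₁, z₁, w₁)`, carrying `σ₁` to the constants
  have hfr : (maximalIdeal S₁).spanFinrank = 4 := by
    have h := (isRegularLocalRing_iff S₁).mp hreg₁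
    rw [hdim₁] at h
    exact_mod_cast h
  obtain ⟨e₁, hex, hev, hez, hew, he₁⟩ :=
    CanonicalCleaning.exists_ringEquiv_mvPowerSeries_four p S₁ hfr (φ x) v₁ z₁ w₁ hspan₁
  have heC : ∀ b', e₁ (σ₁ b') = C b' := ringEquiv_section_eq_C p hp e₁ he₁ σ₁ hσ₁
  have hz₁ : z₁ ∈ maximalIdeal S₁ := by rw [← hspan₁]; exact Ideal.subset_span (by simp)
  have hw₁ : w₁ ∈ maximalIdeal S₁ := by rw [← hspan₁]; exact Ideal.subset_span (by simp)
  -- the relation in coordinates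
  have hrelC : X 0 ^ (a + b) * (C c + X 1) ^ b * e₁ (φ f) = X 0 ^ (2 * k + a₁) * X 1 ^ b₁ * e₁ f₁ := by
    have hy' := map_chart_y φ σ₁ e₁ x y c v₁ heC hex hev hy
    have h := congrArg e₁ hrel
    rw [hu, hu₁] at h
    simp only [map_mul, map_pow, hex, hev, hy'] at h
    -- `h : X0^a * (X0 * (C c + X1))^b * F = X0^(2k) * (X0^a₁ * X1^b₁ * F₁)`
    rw [mul_pow] at h
    rw [pow_add, pow_add]
    calc X 0 ^ a * X 0 ^ b * (C c + X 1) ^ b * e₁ (φ f) = X 0 ^ a * (X 0 ^ b * (C c + X 1) ^ b) * e₁ (φ f) := by ring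
      _ = X 0 ^ (2 * k) * (X 0 ^ a₁ * X 1 ^ b₁ * e₁ f₁) := h
      _ = X 0 ^ (2 * k) * X 0 ^ a₁ * X 1 ^ b₁ * e₁ f₁ := by ring
  -- the two coefficient read-outs
  have hsrc := fun m : Fin 4 →₀ ℕ => fun hmd : m 2 + m 3 = d =>
    coeff_source φ σ σ₁ e₁ x y z w c v₁ z₁ w₁ hσ heC hcompat hspan hex hev hy hz hw hez hew d hd f Ψ hΨ hcong m hmd
  obtain ⟨l, hl, hval⟩ := cone_coeff a b b₁ d (2 * k + a₁) hb c (e₁ (φ f)) (e₁ f₁)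
    (fun i j => residue S₁ (φ (σ (residue S (MvPolynomial.coeff (Finsupp.single 0 i + Finsupp.single 1 j) Ψ)))))
    (fun i j => residue S₁ (MvPolynomial.coeff (Finsupp.single 0 i + Finsupp.single 1 j) Ψ₁)) hrelC
    (fun m hmd hlt => (hsrc m hmd).1 hlt) (fun m hmd heq => (hsrc m hmd).2 heq)
    (fun m hm0 hm1 hmd => coeff_pure_eq_residue_coeff e₁ σ₁ hσ₁ heC (φ x) v₁ z₁ w₁ f₁ hex hev hez hew hz₁ hw₁ d Ψ₁ hΨ₁
      hcong₁ m hm0 hm1 hmd)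
    (exists_coeff_ne_zero_of_map_ne_zero (((residue S₁).comp (φ.comp σ)).comp (residue S)) d Ψ hΨ (by
      intro h0
      apply hΨ0
      -- `ī` is injective, so `Ψ̄ ⊗ κ₁ = 0 ⇒ Ψ̄ = 0`
      have hinj : Function.Injective ((residue S₁).comp (φ.comp σ)) := RingHom.injective _
      rw [← MvPolynomial.map_map] at h0
      exact (MvPolynomial.map_injective _ hinj) (h0.trans (map_zero _).symm)))
    (exists_coeff_ne_zero_of_map_ne_zero (residue S₁) d Ψ₁ hΨ₁ hΨ₁0)
  refine ⟨l, hl, MvPolynomial.ext _ _ fun e => ?_⟩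
  rw [MvPolynomial.coeff_map, MvPolynomial.coeff_C_mul, MvPolynomial.coeff_map]
  by_cases hdeg : e 0 + e 1 = d
  · have h := hval (e 0) (e 1) hdeg
    have hpair : e = Finsupp.single 0 (e 0) + Finsupp.single 1 (e 1) := by ext t; fin_cases t <;> simp
    rw [← hpair] at h
    rw [h]
    rfl
  · rw [hΨ₁.coeff_eq_zero (by rw [Finsupp.degree_eq_sum, Fin.sum_univ_two]; exact hdeg), hΨ.coeff_eq_zero (by rw [Finsupp.degree_eq_sum, Fin.sum_univ_two]; exact hdeg), map_zero,
      map_zero, mul_zero]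

end Core


/-! ## §9 The consumer form: anisotropy of `Ψ̄ ⊗_ī κ₁` (the input of `HatBaseChangeX`'s last clause) -/

section Anisotropy
variable {S S₁ : Type} [CommRing S] [IsLocalRing S] [CommRing S₁] [IsLocalRing S₁]

/-- A form anisotropic over a field is nonzero (`d`-forms with `d ≥ 0`; test vector `(1, 0)`). -/
theorem map_ne_zero_of_anisotropic {A k' : Type} [CommRing A] [Field k'] (g : A →+* k') (Ψ : MvPolynomial (Fin 2) A)
    (han : ∀ a b : k', (a ≠ 0 ∨ b ≠ 0) → MvPolynomial.eval ![a, b] (MvPolynomial.map g Ψ) ≠ 0) :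
    MvPolynomial.map g Ψ ≠ 0 := by
  intro h0
  exact han 1 0 (Or.inl one_ne_zero) (by rw [h0, map_zero])

/-- **CONE ANISOTROPY along an x-chart letter between ARITHMETIC stages** (words-free; the consumer form of cone persistence):
with the data of `conePersistence_core`, if `Ψ̄` is anisotropic over `κ` and `Ψ̄₁` is anisotropic over `κ₁`, then the base change
`Ψ̄ ⊗_ī κ₁` is anisotropic over `κ₁` — exactly the input of the last clause of the β-slot `HatBaseChangeX` (re-cut, RULING 207(a)). -/
theorem coneAnisotropy_core (p : ℕ) (hp : p.Prime) [CharP S₁ p] (hreg₁ : IsRegularLocalRing S₁) [IsAdicComplete (maximalIdeal S₁) S₁]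
    [PerfectField (ResidueField S₁)] (hdim₁ : ringKrullDim S₁ = 4)
    (φ : S →+* S₁) (σ : ResidueField S →+* S) (σ₁ : ResidueField S₁ →+* S₁)
    (hσ : ∀ a, residue S (σ a) = a) (hσ₁ : ∀ b, residue S₁ (σ₁ b) = b)
    (hcompat : ∀ a, φ (σ a) = σ₁ (residue S₁ (φ (σ a))))
    (x y z w u f : S) (c : ResidueField S₁) (v₁ z₁ w₁ u₁ f₁ : S₁)
    (hspan : Ideal.span {x, y, z, w} = maximalIdeal S) (hspan₁ : Ideal.span {φ x, v₁, z₁, w₁} = maximalIdeal S₁)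
    (hy : φ y = φ x * (σ₁ c + v₁)) (hz : φ z = φ x * z₁) (hw : φ w = φ x * w₁)
    (a b a₁ b₁ k d : ℕ) (hb : b ≤ 1) (hd : 1 ≤ d) (hu : u = x ^ a * y ^ b) (hu₁ : u₁ = φ x ^ a₁ * v₁ ^ b₁)
    (hrel : φ (u * f) = φ x ^ (2 * k) * (u₁ * f₁))
    (Ψ : MvPolynomial (Fin 2) S) (hΨ : Ψ.IsHomogeneous d)
    (hcong : f - MvPolynomial.eval ![z, w] Ψ ∈ Ideal.span {x, y} * maximalIdeal S ^ (d - 1) ⊔ maximalIdeal S ^ (d + 1))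
    (hanΨ : ∀ a b : ResidueField S, (a ≠ 0 ∨ b ≠ 0) → MvPolynomial.eval ![a, b] (MvPolynomial.map (residue S) Ψ) ≠ 0)
    (Ψ₁ : MvPolynomial (Fin 2) S₁) (hΨ₁ : Ψ₁.IsHomogeneous d)
    (hcong₁ : f₁ - MvPolynomial.eval ![z₁, w₁] Ψ₁ ∈ Ideal.span {φ x, v₁} * maximalIdeal S₁ ^ (d - 1) ⊔ maximalIdeal S₁ ^ (d + 1))
    (hanΨ₁ : ∀ a b : ResidueField S₁, (a ≠ 0 ∨ b ≠ 0) → MvPolynomial.eval ![a, b] (MvPolynomial.map (residue S₁) Ψ₁) ≠ 0) :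
    ∀ a b : ResidueField S₁, (a ≠ 0 ∨ b ≠ 0) →
      MvPolynomial.eval ![a, b] (MvPolynomial.map (((residue S₁).comp (φ.comp σ)).comp (residue S)) Ψ) ≠ 0 := by
  obtain ⟨l, -, hl⟩ := conePersistence_core p hp hreg₁ hdim₁ φ σ σ₁ hσ hσ₁ hcompat x y z w u f c v₁ z₁ w₁ u₁ f₁ hspan hspan₁
    hy hz hw a b a₁ b₁ k d hb hd hu hu₁ hrel Ψ hΨ hcong (map_ne_zero_of_anisotropic _ Ψ hanΨ) Ψ₁ hΨ₁ hcong₁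
    (map_ne_zero_of_anisotropic _ Ψ₁ hanΨ₁)
  intro a' b' hab h0
  apply hanΨ₁ a' b' hab
  rw [hl, map_mul, MvPolynomial.eval_C, h0, mul_zero]

end Anisotropy
end Summit.ResolutionOfSingularities.ResolutionOfSingularities.Theorems.SwitchingDichotomy.HatBaseChange

end
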